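import Mathlib
import Summits.Ventures.PercRepro.TriangleCapThreeBelowOneTriangleA
import Summits.Ventures.PercRepro.TriangleCapEightThirteenE

/-!
# PercRepro — FOUR BELOW THE DIAGONAL, ONE TRIANGLE: THE OUTER VERTICES AND THE PRIVATE-SET COUNT
(p3, gen 39; part 125)

`S = {u, v, w}` the only triangle, `n = |Sᶜ|`, `q` the outer vertices (no neighbour in `S`), `t_i = degIn Sᶜ i` the
private sets of the triangle vertices (`Σ t_i = n − q`), `σ = Σ t_i²`, `Q′ = Σ_{Sᶜ} degIn Sᶜ = 2 e(Sᶜ)`.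
* **`one_triangle_stability_four_of_outer`** — gen 37's count with the outer degrees
  (`Σ deficit + 6 ≥ 6q + 2m + 2 Σ_{outer} d`) pays `r = 4` as soon as `6q + 2 Σ_{outer} d + 2m + 28 ≥ 8k`; with every
  degree `≥ 2`: `10q + 2m + 28 ≥ 8k` (**`…_of_outer'`**).
* **`one_triangle_stability_four_of_sigma`** — THE PRIVATE-SET COUNT: `Σ_v d² = Σ_S (2 + t_i)² + Σ_{Sᶜ} (s + d)²`
  with `s ∈ {0, 1}`, Mantel inside the triangle-free `Sᶜ` (`2 Σ d² ≤ n Q′`), `Σ s d = Q′ − Σ_{outer} d ≤ Q′ − 2q`,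
  and the density `2m = 6 + 2 (n − q) + Q′` give `Σ_v d² ≤ σ + n m + 4m − n² − 2n + nq − 5q`, so
  `Σ_v d(v)² + 4 (k − 5) ≤ m k` whenever `σ + m + 2n + nq ≤ n² + 5q + 8`.
* **`one_triangle_stability_four_of_five_outer`** — with `σ ≤ (n − q)²` the condition reads
  `m ≤ q (n − q) + 5q − 2n + 8`, which `q ≥ 5` and `m ≤ 3n + 8 = 3k − 1` satisfy: five outer vertices pay for every
  cell `m = 3 (k − 3) − 4`.
What is left of the one-triangle case: `q ≤ 4` when `m ≤ 3k − 1` (the lopsided private sets), `q ≤ 1` when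
`m ≥ 4k − 20` (the outer count pays from `q = 2`), `q = 0` for `m ≥ 5k − 29` and `k ≤ 14`.  Axioms: standard.
-/

namespace PercRepro

namespace TriangleCap

namespace C047

open Finset

variable {V : Type*} [Fintype V] [DecidableEq V]

/-- **FOUR BELOW THE DIAGONAL, ONE TRIANGLE, PAID BY THE OUTER VERTICES:** `6q + 2 Σ_{outer} d + 2m + 28 ≥ 8k` ⇒
`Σ_v d(v)² + 4 (k − 5) ≤ m k`. -/
theorem one_triangle_stability_four_of_outer (D : SimpleGraph V) [DecidableRel D.Adj] (hK : K4mFree D)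
    {u v w : V} (huv : D.Adj u v) (huw : D.Adj u w) (hvw : D.Adj v w)
    (hT : ∀ a b c, D.Adj a b → D.Adj a c → D.Adj b c → a = u ∨ a = v ∨ a = w) (hk : 5 ≤ Fintype.card V)
    (hpay : 8 * Fintype.card V ≤ 6 * ((({u, v, w} : Finset V)ᶜ).filter (fun z => degIn D {u, v, w} z = 0)).card +
      2 * ∑ z ∈ (({u, v, w} : Finset V)ᶜ).filter (fun z => degIn D {u, v, w} z = 0),
        degIn D ({u, v, w} : Finset V)ᶜ z + 2 * D.edgeFinset.card + 28) :
    ∑ v, deg D v * deg D v + 4 * (Fintype.card V - 5) ≤ D.edgeFinset.card * Fintype.card V := by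
  have hlow := one_triangle_deficit_lower_outer D hK huv huw hvw
  have h6 := card_triangles3_le_six D hT
  have hid := two_mul_sum_deg_sq_add_sum_deficit D
  have hmk : 2 * (D.edgeFinset.card * Fintype.card V) = 2 * D.edgeFinset.card * Fintype.card V := by ring
  omega

/-- The outer vertices have degree `degIn Sᶜ`; with every degree `≥ 2` their outside degrees sum to `≥ 2q`. -/
theorem two_mul_card_outer_le_sum (D : SimpleGraph V) [DecidableRel D.Adj] (S : Finset V) (hdeg : ∀ z, 2 ≤ deg D z) :
    2 * (Sᶜ.filter (fun z => degIn D S z = 0)).card ≤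
      ∑ z ∈ Sᶜ.filter (fun z => degIn D S z = 0), degIn D Sᶜ z := by
  rw [card_eq_sum_ones, mul_sum]
  apply sum_le_sum
  intro z hz
  rw [mem_filter] at hz
  have h1 := hdeg z
  have h2 := deg_eq_degIn_add_degIn_compl D S z
  rw [hz.2] at h2
  omega

/-- **FOUR BELOW THE DIAGONAL, ONE TRIANGLE, PAID BY THE OUTER VERTICES (every degree `≥ 2`):**
`10q + 2m + 28 ≥ 8k` ⇒ `Σ_v d(v)² + 4 (k − 5) ≤ m k`. -/
theorem one_triangle_stability_four_of_outer' (D : SimpleGraph V) [DecidableRel D.Adj] (hK : K4mFree D)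
    {u v w : V} (huv : D.Adj u v) (huw : D.Adj u w) (hvw : D.Adj v w)
    (hT : ∀ a b c, D.Adj a b → D.Adj a c → D.Adj b c → a = u ∨ a = v ∨ a = w) (hk : 5 ≤ Fintype.card V)
    (hdeg : ∀ z, 2 ≤ deg D z)
    (hpay : 8 * Fintype.card V ≤ 10 * ((({u, v, w} : Finset V)ᶜ).filter (fun z => degIn D {u, v, w} z = 0)).card +
      2 * D.edgeFinset.card + 28) :
    ∑ v, deg D v * deg D v + 4 * (Fintype.card V - 5) ≤ D.edgeFinset.card * Fintype.card V := by
  have h := two_mul_card_outer_le_sum D {u, v, w} hdeg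
  exact one_triangle_stability_four_of_outer D hK huv huw hvw hT hk (by omega)

/-- **THE PRIVATE-SET COUNT:** one triangle `S`, every degree `≥ 2` ⇒
`Σ_v d(v)² + n² + 2n + 5q ≤ σ + n m + 4 m + n q`, with `n = |Sᶜ|`, `q` the outer vertices and
`σ = Σ_{i ∈ S} (degIn Sᶜ i)²`. -/
theorem one_triangle_count_sigma (D : SimpleGraph V) [DecidableRel D.Adj] (hK : K4mFree D)
    {u v w : V} (huv : D.Adj u v) (huw : D.Adj u w) (hvw : D.Adj v w)
    (hT : ∀ a b c, D.Adj a b → D.Adj a c → D.Adj b c → a = u ∨ a = v ∨ a = w) (hdeg : ∀ z, 2 ≤ deg D z) :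
    2 * ∑ v, deg D v * deg D v + 2 * ((({u, v, w} : Finset V)ᶜ).card * (({u, v, w} : Finset V)ᶜ).card) +
        4 * (({u, v, w} : Finset V)ᶜ).card +
        10 * ((({u, v, w} : Finset V)ᶜ).filter (fun z => degIn D {u, v, w} z = 0)).card ≤
      2 * ∑ x ∈ ({u, v, w} : Finset V), degIn D ({u, v, w} : Finset V)ᶜ x * degIn D ({u, v, w} : Finset V)ᶜ x +
        2 * ((({u, v, w} : Finset V)ᶜ).card * D.edgeFinset.card) + 8 * D.edgeFinset.card +
        2 * ((({u, v, w} : Finset V)ᶜ).card *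
          ((({u, v, w} : Finset V)ᶜ).filter (fun z => degIn D {u, v, w} z = 0)).card) := by
  set S : Finset V := {u, v, w} with hS
  have h3 : S.card = 3 := card_triple huv.ne huw.ne hvw.ne
  have hcl := clique_triple D huv huw hvw
  have hone : ∀ z ∈ Sᶜ, degIn D S z ≤ 1 := fun z hz => degIn_le_one_of_triangle D hK huv huw hvw (mem_compl.mp hz)
  -- no triangle inside `Sᶜ`
  have hnotri : ∀ y ∈ Sᶜ, ∀ y' ∈ Sᶜ, ∀ t ∈ Sᶜ, D.Adj y y' → D.Adj y t → D.Adj y' t → False := by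
    intro y hy y' _ t _ hyy' hyt _
    rw [mem_compl, hS] at hy
    simp only [mem_insert, mem_singleton, not_or] at hy
    rcases hT y y' t hyy' hyt (by assumption) with h | h | h
    · exact hy.1 h
    · exact hy.2.1 h
    · exact hy.2.2 h
  have hMantel := two_mul_sum_sq_le_of_no_triangle D Sᶜ hnotri
  -- the density
  have hdens := two_mul_card_edges_eq_adjPairs_add D S
  have hQ6 : adjPairs D S = 6 := by
    rw [adjPairs_eq_sum_degIn]
    calc ∑ x ∈ S, degIn D S x = ∑ _x ∈ S, 2 := sum_congr rfl (fun x hx => degIn_self_of_clique D h3 hcl hx)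
      _ = 6 := by rw [sum_const, h3, smul_eq_mul]
  rw [hQ6] at hdens
  -- the outer vertices: `Σ s = n − q`, `Σ s d + Σ_{outer} d = Q′`, `Σ_{outer} d ≥ 2q`
  have hsq := sum_degIn_mul_add_sum_outer D S hone
  have houter := two_mul_card_outer_le_sum D S hdeg
  have hsum_s : ∑ z ∈ Sᶜ, degIn D S z + (Sᶜ.filter (fun z => degIn D S z = 0)).card = Sᶜ.card := by
    have hc := card_filter_add_card_filter_not (fun z => degIn D S z = 0) (s := Sᶜ)
    have h1 : ∑ z ∈ Sᶜ, degIn D S z = (Sᶜ.filter (fun z => ¬ degIn D S z = 0)).card := by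
      rw [card_eq_sum_ones, sum_filter]
      apply sum_congr rfl
      intro z hz
      have := hone z hz
      by_cases h0 : degIn D S z = 0
      · simp only [h0, not_true_eq_false, if_false]
      · simp only [h0, not_false_eq_true, if_true]; omega
    omega
  -- the degree sums over `S` and `Sᶜ`
  have hsplit := sum_add_sum_compl S (fun v => deg D v * deg D v)
  have hS_sum : ∑ x ∈ S, deg D x * deg D x =
      12 + 4 * ∑ x ∈ S, degIn D Sᶜ x + ∑ x ∈ S, degIn D Sᶜ x * degIn D Sᶜ x := by
    have e : ∀ x ∈ S, deg D x * deg D x = 4 + 4 * degIn D Sᶜ x + degIn D Sᶜ x * degIn D Sᶜ x := by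
      intro x hx
      rw [deg_eq_degIn_add_degIn_compl D S x, degIn_self_of_clique D h3 hcl hx]
      ring
    rw [sum_congr rfl e, sum_add_distrib, sum_add_distrib, sum_const, h3, smul_eq_mul, mul_sum]
  have hSc_sum : ∑ x ∈ Sᶜ, deg D x * deg D x =
      ∑ x ∈ Sᶜ, degIn D S x + 2 * ∑ x ∈ Sᶜ, degIn D S x * degIn D Sᶜ x +
        ∑ x ∈ Sᶜ, degIn D Sᶜ x * degIn D Sᶜ x := by
    have e : ∀ x ∈ Sᶜ, deg D x * deg D x =
        degIn D S x + 2 * (degIn D S x * degIn D Sᶜ x) + degIn D Sᶜ x * degIn D Sᶜ x := by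
      intro x hx
      rw [deg_eq_degIn_add_degIn_compl D S x]
      have h1 := hone x hx
      have hs : degIn D S x * degIn D S x = degIn D S x := by
        rcases Nat.le_one_iff_eq_zero_or_eq_one.mp h1 with h | h <;> rw [h]
      nlinarith [hs]
    rw [sum_congr rfl e, sum_add_distrib, sum_add_distrib, mul_sum]
  -- the double count `Σ_S degIn Sᶜ = Σ_{Sᶜ} degIn S`
  have hcomm := sum_degIn_comm D S Sᶜ
  rw [← hsplit, hS_sum, hSc_sum, hcomm]
  -- `σ` is read off the goal; everything else is linear
  nlinarith [hMantel, hdens, hsq, houter, hsum_s]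

/-- **FOUR BELOW THE DIAGONAL, ONE TRIANGLE, BY THE PRIVATE SETS:** every degree `≥ 2` and
`σ + m + 2n + n q ≤ n² + 5q + 8` ⇒ `Σ_v d(v)² + 4 (k − 5) ≤ m k`. -/
theorem one_triangle_stability_four_of_sigma (D : SimpleGraph V) [DecidableRel D.Adj] (hK : K4mFree D)
    {u v w : V} (huv : D.Adj u v) (huw : D.Adj u w) (hvw : D.Adj v w)
    (hT : ∀ a b c, D.Adj a b → D.Adj a c → D.Adj b c → a = u ∨ a = v ∨ a = w) (hk : 10 ≤ Fintype.card V)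
    (hdeg : ∀ z, 2 ≤ deg D z)
    (hcond : ∑ x ∈ ({u, v, w} : Finset V), degIn D ({u, v, w} : Finset V)ᶜ x * degIn D ({u, v, w} : Finset V)ᶜ x +
      D.edgeFinset.card + 2 * (({u, v, w} : Finset V)ᶜ).card +
      (({u, v, w} : Finset V)ᶜ).card * ((({u, v, w} : Finset V)ᶜ).filter (fun z => degIn D {u, v, w} z = 0)).card ≤
      (({u, v, w} : Finset V)ᶜ).card * (({u, v, w} : Finset V)ᶜ).card +
        5 * ((({u, v, w} : Finset V)ᶜ).filter (fun z => degIn D {u, v, w} z = 0)).card + 8) :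
    ∑ v, deg D v * deg D v + 4 * (Fintype.card V - 5) ≤ D.edgeFinset.card * Fintype.card V := by
  have hcount := one_triangle_count_sigma D hK huv huw hvw hT hdeg
  have hkn : Fintype.card V = (({u, v, w} : Finset V)ᶜ).card + 3 := by
    rw [card_compl, card_triple huv.ne huw.ne hvw.ne]
    have : ({u, v, w} : Finset V).card ≤ Fintype.card V := card_le_univ _
    rw [card_triple huv.ne huw.ne hvw.ne] at this
    omega
  rw [hkn] at hk ⊢
  obtain ⟨n, hn⟩ : ∃ n, (({u, v, w} : Finset V)ᶜ).card = n := ⟨_, rfl⟩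
  rw [hn] at hcount hcond hk ⊢
  obtain ⟨q, hq⟩ : ∃ q, ((({u, v, w} : Finset V)ᶜ).filter (fun z => degIn D {u, v, w} z = 0)).card = q := ⟨_, rfl⟩
  rw [hq] at hcount hcond
  obtain ⟨σ, hσ⟩ : ∃ σ, ∑ x ∈ ({u, v, w} : Finset V), degIn D ({u, v, w} : Finset V)ᶜ x *
      degIn D ({u, v, w} : Finset V)ᶜ x = σ := ⟨_, rfl⟩
  rw [hσ] at hcount hcond
  obtain ⟨n', rfl⟩ : ∃ n', n = n' + 7 := ⟨n - 7, by omega⟩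
  have e : n' + 7 + 3 - 5 = n' + 5 := by omega
  rw [e]
  nlinarith [hcount, hcond]

omit [Fintype V] [DecidableEq V] in
/-- `Σ t_i² ≤ (Σ t_i)²` for three summands. -/
theorem sum_sq_le_sq_sum_three (a b c : ℕ) : a * a + b * b + c * c ≤ (a + b + c) * (a + b + c) := by nlinarith

/-- `σ ≤ s²` with `s = Σ_{Sᶜ} degIn S = n − q` the number of private vertices. -/
theorem sigma_le_sq (D : SimpleGraph V) [DecidableRel D.Adj] (hK : K4mFree D)
    {u v w : V} (huv : D.Adj u v) (huw : D.Adj u w) (hvw : D.Adj v w) :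
    (∑ z ∈ ({u, v, w} : Finset V)ᶜ, degIn D {u, v, w} z) +
        ((({u, v, w} : Finset V)ᶜ).filter (fun z => degIn D {u, v, w} z = 0)).card = (({u, v, w} : Finset V)ᶜ).card ∧
      ∑ x ∈ ({u, v, w} : Finset V), degIn D ({u, v, w} : Finset V)ᶜ x * degIn D ({u, v, w} : Finset V)ᶜ x ≤
        (∑ z ∈ ({u, v, w} : Finset V)ᶜ, degIn D {u, v, w} z) * (∑ z ∈ ({u, v, w} : Finset V)ᶜ, degIn D {u, v, w} z) := by
  set S : Finset V := {u, v, w} with hS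
  have hone : ∀ z ∈ Sᶜ, degIn D S z ≤ 1 := fun z hz => degIn_le_one_of_triangle D hK huv huw hvw (mem_compl.mp hz)
  have hsum_s : ∑ z ∈ Sᶜ, degIn D S z + (Sᶜ.filter (fun z => degIn D S z = 0)).card = Sᶜ.card := by
    have hc := card_filter_add_card_filter_not (fun z => degIn D S z = 0) (s := Sᶜ)
    have h1 : ∑ z ∈ Sᶜ, degIn D S z = (Sᶜ.filter (fun z => ¬ degIn D S z = 0)).card := by
      rw [card_eq_sum_ones, sum_filter]
      apply sum_congr rfl
      intro z hz
      have := hone z hz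
      by_cases h0 : degIn D S z = 0
      · simp only [h0, not_true_eq_false, if_false]
      · simp only [h0, not_false_eq_true, if_true]; omega
    omega
  refine ⟨hsum_s, ?_⟩
  have hcomm := sum_degIn_comm D S Sᶜ
  rw [← hcomm]
  have huvw : u ∉ ({v, w} : Finset V) := by
    rw [mem_insert, mem_singleton, not_or]; exact ⟨huv.ne, huw.ne⟩
  have hvw' : v ∉ ({w} : Finset V) := by rw [mem_singleton]; exact hvw.ne
  rw [hS, sum_insert huvw, sum_insert hvw', sum_singleton, sum_insert huvw, sum_insert hvw', sum_singleton]
  nlinarith [sum_sq_le_sq_sum_three (degIn D ({u, v, w} : Finset V)ᶜ u) (degIn D ({u, v, w} : Finset V)ᶜ v)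
    (degIn D ({u, v, w} : Finset V)ᶜ w)]

/-- **FIVE OUTER VERTICES PAY FOR `m ≤ 3k − 1`:** one triangle, `k ≥ 10`, every degree `≥ 2`, at least five outer
vertices, `m + 1 ≤ 3k` ⇒ `Σ_v d(v)² + 4 (k − 5) ≤ m k`. -/
theorem one_triangle_stability_four_of_five_outer (D : SimpleGraph V) [DecidableRel D.Adj] (hK : K4mFree D)
    {u v w : V} (huv : D.Adj u v) (huw : D.Adj u w) (hvw : D.Adj v w)
    (hT : ∀ a b c, D.Adj a b → D.Adj a c → D.Adj b c → a = u ∨ a = v ∨ a = w) (hk : 10 ≤ Fintype.card V)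
    (hdeg : ∀ z, 2 ≤ deg D z)
    (hq : 5 ≤ ((({u, v, w} : Finset V)ᶜ).filter (fun z => degIn D {u, v, w} z = 0)).card)
    (hm : D.edgeFinset.card + 1 ≤ 3 * Fintype.card V) :
    ∑ v, deg D v * deg D v + 4 * (Fintype.card V - 5) ≤ D.edgeFinset.card * Fintype.card V := by
  apply one_triangle_stability_four_of_sigma D hK huv huw hvw hT hk hdeg
  obtain ⟨hsum, hsig⟩ := sigma_le_sq D hK huv huw hvw
  have hkn : Fintype.card V = (({u, v, w} : Finset V)ᶜ).card + 3 := by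
    rw [card_compl, card_triple huv.ne huw.ne hvw.ne]
    have : ({u, v, w} : Finset V).card ≤ Fintype.card V := card_le_univ _
    rw [card_triple huv.ne huw.ne hvw.ne] at this
    omega
  rw [hkn] at hm
  obtain ⟨n, hn⟩ : ∃ n, (({u, v, w} : Finset V)ᶜ).card = n := ⟨_, rfl⟩
  obtain ⟨q, hq'⟩ : ∃ q, ((({u, v, w} : Finset V)ᶜ).filter (fun z => degIn D {u, v, w} z = 0)).card = q := ⟨_, rfl⟩
  obtain ⟨σ, hσ⟩ : ∃ σ, ∑ x ∈ ({u, v, w} : Finset V), degIn D ({u, v, w} : Finset V)ᶜ x *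
      degIn D ({u, v, w} : Finset V)ᶜ x = σ := ⟨_, rfl⟩
  obtain ⟨s, hs⟩ : ∃ s, ∑ z ∈ ({u, v, w} : Finset V)ᶜ, degIn D {u, v, w} z = s := ⟨_, rfl⟩
  rw [hn, hq', hs] at hsum
  rw [hσ, hs] at hsig
  rw [hn, hq', hσ]
  rw [hq'] at hq
  rw [hn] at hm
  subst hsum
  have hkey : 5 * s ≤ q * s := Nat.mul_le_mul_right s hq
  nlinarith [hsig, hkey, hm]

end C047

end TriangleCap

end PercRepro
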